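import Summits.QuantumFields.YangMills.Theorems.IR.BlockedActivityWCentreRatio
import Summits.QuantumFields.YangMills.Theorems.IR.BlockedActivityWSharp
import HarnessLib

/-!
# Crux `IR` (stmt-QuantumFields-19354), lane B «strong coupling AFTER BLOCKING»: RATIO clause (i) — the junction of the activity currency of
# record with the onset formats (every `β`)

Helper module for item `stmt-QuantumFields-19354` (`--supports`; it closes nothing), lane `ym-19354-onsetsc-p2` (g3).

WHAT IS HERE (all proved, every `β`, every compact `G`).
* `blockedRepOn_of_pairRatio_le` — the Typ-ready form of the dictionary of `Theorems/IR/BlockedActivityWCentreRatio`: a PAIRWISE multiplicative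
  oscillation bound of the centre-conditioned ratio among the data of `S` gives `BlockedRepOn ρ β w Y (e^{A} − 1) S` (reference = the kernel of any
  datum of `S`; vacuous representation if `S = ∅`).
* `RatioClauseI ρ β w n A Typ` — clause (i) of the onset formats (`FixedMesh.ClauseI`, total variation `≤ ε`) in RATIO form: for two data typical off
  `Y` that agree on the window collar the centre-conditioned ratio oscillates by at most `e^{A}`.
  **`blockedActivityTypW_of_ratioClauseI`**: `RatioClauseI ρ β w n A Typ → BlockedActivityTypW ρ β w n (e^{A} − 1) Typ` (and the `All` form) — the
  activity conjunct `BlockedActivityTypWAll r.ρ β w n (radiusT ε) Typ` of the lane-B supplier target of record `BlockedActivityTypOnsetCalSCWTolG`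
  (p542635) follows from RATIO clause (i) at `A = log(1 + radiusT ε)` for the SAME class `Typ` (e.g. the LEAD's `TypChain`); conversely the class gives
  total-variation clause (i) (`clauseI_of_ratioClauseI`, through `clauseI_of_blockedActivityTypW_sharp`).
  HONEST READING for the owner: the W|Typ activity conjunct is SANDWICHED between ratio- and total-variation clause (i) for the same `Typ`; as a
  supplier obligation it is clause (i) in sup-norm clothing, not an independent «convergent expansion at scale b» input.  The strong-coupling instance
  (`RatioClauseI` for EVERY `Typ` at every mesh in `216·N·|β| ≤ 1`) is in `Theorems/IR/BlockedActivityWStrongCouplingMeshes`.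

HONEST FRAMING: format theorems; nothing about weak coupling, a gap or Clay.  No `sorry`; axioms ⊆ {propext, Classical.choice, Quot.sound}; no
instances, no notation.
-/

set_option autoImplicit false

noncomputable section

open MeasureTheory ProbabilityTheory
open Literature.MathematicalPhysics.QuantumLattice
open Literature.Probability.LatticeModels
open Summit.QuantumFields.YangMills.Cruxes.IR.Tempered (cellEdges windowCells regionEdges collarEdges)
open Summit.QuantumFields.YangMills.Cruxes.IR.CellTempered.Engine (shiftFrame shiftFrame_mesh)
open Summit.QuantumFields.YangMills.Cruxes.IR.FixedMesh (ClauseI)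

namespace Summit.QuantumFields.YangMills.Cruxes.IR.BlockedActivity

/-! ## §1 The pairwise (Typ-ready) dictionary and RATIO clause (i) -/

section Pair

variable {G : Type} [Group G] [TopologicalSpace G] [IsTopologicalGroup G] [CompactSpace G]
  [MeasurableSpace G] [BorelSpace G] {N : ℕ} {ρ : G →* Matrix (Fin N) (Fin N) ℂ} {β : ℝ}
  {w : Fin 4 → ℤ → ℤ} {n : ℕ} {A ε : ℝ}

/-- **Pairwise dictionary.**  If the centre-conditioned ratio of any two data of `S` oscillates multiplicatively by at most `e^{A}`, then
`BlockedRepOn ρ β w Y (e^{A} − 1) S` (single-cell tilt on the kernel of an arbitrary datum of `S`; vacuous representation if `S = ∅`). -/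
theorem blockedRepOn_of_pairRatio_le [T2Space G] [SecondCountableTopology G] (hρ : Continuous ρ) {Y : Finset Cell} (h0 : (0 : Cell) ∈ Y)
    {S : Set (LGConfig 4 G)} (hA : 0 ≤ A)
    (hpair : ∀ τ ∈ S, ∀ σ ∈ S, ∀ U U', centreRatio ρ β w Y σ τ U ≤ Real.exp A * centreRatio ρ β w Y σ τ U') :
    Nonempty (BlockedRepOn ρ β w Y (Real.exp A - 1) S) := by
  by_cases hS : S.Nonempty
  · obtain ⟨τ, hτ⟩ := hS
    exact blockedRepOn_of_centreRatio_le hρ h0 τ hA fun σ hσ => hpair τ hτ σ hσ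
  · rw [Set.not_nonempty_iff_eq_empty] at hS
    subst hS
    exact blockedRepOn_of_centreRatio_le hρ h0 (fun _ => (1 : G)) hA fun σ hσ => absurd hσ (Set.notMem_empty σ)

/-- **RATIO clause (i)** at the frame `w`, window `n`, class `Typ`, log-oscillation `A`: for two exterior data typical off the region on the
window-plus-shell cells and agreeing on the window collar, the centre-conditioned boundary ratio oscillates by at most `e^{A}` — the sup-norm
(multiplicative) companion of `FixedMesh.ClauseI ρ β w n ε Typ` (total variation `≤ ε`). -/
def RatioClauseI {N : ℕ} (ρ : G →* Matrix (Fin N) (Fin N) ℂ) (β : ℝ) (w : Fin 4 → ℤ → ℤ) (n : ℕ) (A : ℝ)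
    (Typ : Cell → Set (LGConfig 4 G)) : Prop :=
  ∀ Y : Finset Cell, Y ⊆ windowCells n → (0 : Cell) ∈ Y →
    ∀ σ σ' : LGConfig 4 G, σ ∈ TypicalOff n Y Typ → σ' ∈ TypicalOff n Y Typ → σ' ∈ WindowAgree w n Y σ →
      ∀ U U', centreRatio ρ β w Y σ' σ U ≤ Real.exp A * centreRatio ρ β w Y σ' σ U'

/-- **RATIO clause (i) ⇒ the W|Typ activity class** with radius `e^{A} − 1`, for the SAME `Typ`. -/
theorem blockedActivityTypW_of_ratioClauseI [T2Space G] [SecondCountableTopology G] (hρ : Continuous ρ) (hA : 0 ≤ A)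
    {Typ : Cell → Set (LGConfig 4 G)} (h : RatioClauseI ρ β w n A Typ) : BlockedActivityTypW ρ β w n (Real.exp A - 1) Typ :=
  fun Y hY h0 _ =>
    blockedRepOn_of_pairRatio_le hρ h0 hA fun τ' hτ' σ hσ =>
      h Y hY h0 τ' σ hτ'.2 hσ.2 fun e he => (hσ.1 e he).trans (hτ'.1 e he).symm

/-- … at every centre (`BlockedActivityTypWAll`, the `Act` shape of cplan's (6d) ∕ of `…TolG`). -/
theorem blockedActivityTypWAll_of_ratioClauseI [T2Space G] [SecondCountableTopology G] (hρ : Continuous ρ) (hA : 0 ≤ A)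
    {Typ : Cell → Set (LGConfig 4 G)} (h : ∀ c₀ : Cell, RatioClauseI ρ β (shiftFrame w c₀) n A (fun c => Typ (c + c₀))) :
    BlockedActivityTypWAll ρ β w n (Real.exp A - 1) Typ :=
  fun c₀ => blockedActivityTypW_of_ratioClauseI hρ hA (h c₀)

/-- **RATIO clause (i) ⇒ total-variation clause (i)** through the class (tree `clauseI_of_blockedActivityTypW_sharp`): if `e^{A} − 1 ≤ radiusKP ε`,
`ε ≤ 1`, then `RatioClauseI ρ β w n A Typ → ClauseI ρ β w n ε Typ`. -/
theorem clauseI_of_ratioClauseI [T2Space G] [SecondCountableTopology G] (hρ : Continuous ρ) (hA : 0 ≤ A)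
    {Typ : Cell → Set (LGConfig 4 G)} (h : RatioClauseI ρ β w n A Typ) (hε1 : ε ≤ 1) (hAε : Real.exp A - 1 ≤ radiusKP ε) :
    ClauseI ρ β w n ε Typ :=
  clauseI_of_blockedActivityTypW_sharp (blockedActivityTypW_of_ratioClauseI hρ hA h) hε1 hAε

end Pair

end Summit.QuantumFields.YangMills.Cruxes.IR.BlockedActivity

end
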